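import Literature.AlgebraicGeometry.HodgeTheory.TopDegreeClasses
import Literature.AlgebraicGeometry.HodgeTheory.AlgebraicClassesCup
import Literature.AlgebraicGeometry.Motives.ComplexPointsManifold
import HarnessLib

/-!
# `Nˡ H²ˡ ∪ Nᵏ H²ᵏ ⊆ Nˡ⁺ᵏ H²ˡ⁺²ᵏ` off the moving range: `l = 0`, `k = 0`, or `l + k ≥ dim X` (proved)

Family `hodge`; helper toward the support item `CupProductAlgebraic` of the route
`Summits/HodgeConjecture/HodgeConjecture/Theses/EndoscopicMiddleDegree` (Voisin II Prop. 9.20 on the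
coniveau carrier `algebraicClasses X p = Nᵖ H²ᵖ(X(ℂ); ℂ)`, for `X` smooth projective of dimension `n`
over `ℂ`). The tree reduces the statement to a MOVING hypothesis
(`cupProduct_mem_algebraicClasses_of_moving`, file `AlgebraicClassesCup`; only irreducible supports
matter, `SupportedClassesIrreducible`). This file proves, unconditionally, every bidegree in which
no moving is needed:

* `cupProduct_mem_algebraicClasses_zero_left` — `l = 0`: `H⁰ ∪ Nᵏ H²ᵏ ⊆ Nᵏ H²ᵏ` (take `T = Z`; the
  companion of the tree's `cupProduct_mem_algebraicClasses_zero_right`);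
* `cupProduct_mem_algebraicClasses_of_dim_le_add` — `n ≤ l + k`: for `l + k = n ≥ 1` every class of
  `H²ⁿ(X(ℂ); ℂ)` is algebraic (the class of a point, the tree's `mem_algebraicClasses_of_degree_top`),
  for `n = 0` everything is `N⁰ = ⊤`, and for `l + k > n` the group `H^{2(l+k)}(X(ℂ); ℂ)` vanishes
  (`ComplexPoints.subsingleton_singularCohomology_of_lt`);
* `cupProduct_mem_algebraicClasses_offRange` — the disjunction `l = 0 ∨ k = 0 ∨ n ≤ l + k`;
* `cupProduct_mem_algebraicClasses_of_dim_le_two` — hence the FULL statement for curves and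
  surfaces (`n ≤ 2`: if `l, k ≥ 1` then `l + k ≥ 2 ≥ n`).

What remains of `CupProductAlgebraic` is exactly the range `1 ≤ l`, `1 ≤ k`, `l + k < n` (first case:
`(l, k) = (1, 1)` on a threefold), where the moving hypothesis has content (Chow's moving lemma /
purity of `ker (H²ˡ(X) → H²ˡ(X ∖ Z))`, see the module docstring of `AlgebraicClassesCup`).

## References

* [VoisinHodgeII2003] C. Voisin, Hodge Theory and Complex Algebraic Geometry II (CUP 2003), §9.2.4
  Prop. 9.20.
* [Fulton1998] W. Fulton, Intersection Theory, 2nd ed. (1998), §19.1 Lemma 19.1.1, §19.2 Cor. 19.2.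
* [HatcherAT2002] A. Hatcher, Algebraic Topology (CUP 2002), §3.3 Thm. 3.26 (c), Prop. 3.29.
-/

noncomputable section

open CategoryTheory AlgebraicGeometry

namespace Literature.AlgebraicGeometry.HodgeTheory

section HodgeTheory

open Literature.AlgebraicTopology.SingularHomology Literature.AlgebraicGeometry.Motives

variable {n : ℕ} {X : Motives.SchemeOver ℂ}

/-- **`l = 0`: `H⁰(X(ℂ); ℂ) ∪ Nᵏ H²ᵏ ⊆ Nᵏ H²ᵏ`** (no moving needed: a class `a` dying off a closed `Z`
of codimension `≥ 0` already meets every closed `W` of codimension `≥ k` in codimension `≥ 0 + k`,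
so `T = Z` serves in the moving hypothesis of `cupProduct_mem_algebraicClasses_of_moving`). The degrees
`2 * 0 + 2 * k = 2 * (0 + k)` are those of the route's rendering `two_mul_add_two_mul 0 k`.
[cite: VoisinHodgeII2003, §9.2.4 Prop. 9.20] -/
theorem cupProduct_mem_algebraicClasses_zero_left {k : ℕ} {a : complexBetti X (2 * 0)}
    {b : complexBetti X (2 * k)} (ha : a ∈ algebraicClasses X 0) (hb : b ∈ algebraicClasses X k) :
    cupProduct (two_mul_add_two_mul 0 k) a b ∈ algebraicClasses X (0 + k) :=
  cupProduct_mem_algebraicClasses_of_moving (l := 0) (k := k)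
    (fun _ _ hZ _ _ hWk ↦ ker_restrictCompl_le_iSup_of_inter hZ fun t ht ↦ by
      simpa using hWk t ht.2)
    ha hb

/-- **`n ≤ l + k`: products landing in or above the top degree are algebraic.** For `X` smooth
projective of dimension `n` over `ℂ`, `a ∈ H²ˡ(X(ℂ); ℂ)`, `b ∈ H²ᵏ(X(ℂ); ℂ)` and `n ≤ l + k`, the class
`a ∪ b ∈ H^{2(l+k)}(X(ℂ); ℂ)` lies in `Nˡ⁺ᵏ`: if `l + k = n ≥ 1` every top-degree class is supported on
a closed point (`mem_algebraicClasses_of_degree_top`, Hatcher Prop. 3.29 on `X(ℂ) ∖ {P}`); if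
`l + k = n = 0` then `N⁰ = ⊤` (`algebraicClasses_zero`); if `l + k > n` then
`H^{2(l+k)}(X(ℂ); ℂ) = 0` (`ComplexPoints.subsingleton_singularCohomology_of_lt`, Hatcher
Thm. 3.26 (c) with universal coefficients). No hypothesis on `a`, `b` is needed.
[cite: VoisinHodgeII2003, §10.2.3 proof of Prop. 10.26] [cite: HatcherAT2002, §3.3 Thm. 3.26 (c) and Prop. 3.29] -/
theorem cupProduct_mem_algebraicClasses_of_dim_le_add (hX : IsSmoothProjective n X) {l k : ℕ}
    (hn : n ≤ l + k) (a : complexBetti X (2 * l)) (b : complexBetti X (2 * k)) :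
    cupProduct (two_mul_add_two_mul l k) a b ∈ algebraicClasses X (l + k) := by
  rcases hn.lt_or_eq with hlt | heq
  · -- above the top degree the cohomology vanishes
    haveI := ComplexPoints.subsingleton_singularCohomology_of_lt hX ℂ (k := 2 * (l + k)) (by omega)
    rw [Subsingleton.elim (cupProduct (two_mul_add_two_mul l k) a b) 0]
    exact Submodule.zero_mem _
  · -- the top degree: every class is the class of a point (or `n = 0`, where `N⁰ = ⊤`)
    subst heq
    rcases Nat.eq_zero_or_pos (l + k) with h0 | hpos
    · obtain ⟨rfl, rfl⟩ : l = 0 ∧ k = 0 := by omega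
      show _ ∈ algebraicClasses X 0
      rw [algebraicClasses_zero]
      exact Submodule.mem_top
    · exact mem_algebraicClasses_of_degree_top hX hpos _

/-- **`Nˡ H²ˡ ∪ Nᵏ H²ᵏ ⊆ Nˡ⁺ᵏ H²ˡ⁺²ᵏ` off the moving range.** For `X` smooth projective of dimension `n`
over `ℂ`, `a ∈ Nˡ H²ˡ(X(ℂ); ℂ)`, `b ∈ Nᵏ H²ᵏ(X(ℂ); ℂ)`, and `l = 0 ∨ k = 0 ∨ n ≤ l + k`, the product
`a ∪ b` lies in `Nˡ⁺ᵏ H^{2(l+k)}(X(ℂ); ℂ)` (Voisin II Prop. 9.20 in these bidegrees, unconditionally: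
`cupProduct_mem_algebraicClasses_zero_left`, the tree's `cupProduct_mem_algebraicClasses_zero_right`,
`cupProduct_mem_algebraicClasses_of_dim_le_add`). The remaining range `1 ≤ l`, `1 ≤ k`, `l + k < n`
is where Chow's moving lemma enters in print. [cite: VoisinHodgeII2003, §9.2.4 Prop. 9.20]
[cite: Fulton1998, §19.2 Cor. 19.2] -/
theorem cupProduct_mem_algebraicClasses_offRange (hX : IsSmoothProjective n X) {l k : ℕ}
    (hlk : l = 0 ∨ k = 0 ∨ n ≤ l + k) {a : complexBetti X (2 * l)} {b : complexBetti X (2 * k)}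
    (ha : a ∈ algebraicClasses X l) (hb : b ∈ algebraicClasses X k) :
    cupProduct (two_mul_add_two_mul l k) a b ∈ algebraicClasses X (l + k) := by
  rcases hlk with rfl | rfl | hn
  · exact cupProduct_mem_algebraicClasses_zero_left ha hb
  · exact cupProduct_mem_algebraicClasses_zero_right ha b
  · exact cupProduct_mem_algebraicClasses_of_dim_le_add hX hn a b

/-- **Curves and surfaces: `Nˡ H²ˡ ∪ Nᵏ H²ᵏ ⊆ Nˡ⁺ᵏ H²ˡ⁺²ᵏ` in every bidegree** for `X` smooth projective
of dimension `n ≤ 2` over `ℂ` (if `l ≥ 1` and `k ≥ 1` then `l + k ≥ 2 ≥ n`, otherwise a factor has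
degree `0`): Voisin II Prop. 9.20 on the coniveau carrier, unconditionally in dimension `≤ 2`.
[cite: VoisinHodgeII2003, §9.2.4 Prop. 9.20] -/
theorem cupProduct_mem_algebraicClasses_of_dim_le_two (hX : IsSmoothProjective n X) (hn : n ≤ 2)
    (l k : ℕ) {a : complexBetti X (2 * l)} {b : complexBetti X (2 * k)}
    (ha : a ∈ algebraicClasses X l) (hb : b ∈ algebraicClasses X k) :
    cupProduct (two_mul_add_two_mul l k) a b ∈ algebraicClasses X (l + k) :=
  cupProduct_mem_algebraicClasses_offRange hX (by omega) ha hb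

end HodgeTheory

end Literature.AlgebraicGeometry.HodgeTheory

end
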